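import Mathlib
import Summits.HodgeConjecture.HodgeConjecture.Theorems.R90S6BiregularTreeSphereEven   -- ★ W6-b + `ncard_sphere_eq_of_parity_biregular_tree` (every radius)

/-!
# R90 · S6 «Ch. 14.1–14.5 stable trace formula» — WAVE 6 helper W6-b′: odd spheres of a bi-regular tree

Companion of ★ W6-b (`Theorems/R90S6BiregularTreeSphereEven.lean`): in a locally finite tree in which every vertex at EVEN
distance from `x₀` has degree `a + 1` and every vertex at ODD distance has degree `b + 1`, the sphere of radius `2m + 1` about
`x₀` has `(a+1)·(ab)^m` vertices (special vertices at distance `2m+1` of the Bruhat–Tits tree of `U(3)` at an inert place,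
`a = q³`, `b = q`).  PROOF = the every-radius parity form ★ `R90.S6.ncard_sphere_eq_of_parity_biregular_tree`
(`#S_n(x₀) = (a+1) · b^⌊n∕2⌋ · a^⌊(n−1)∕2⌋`, itself ★ `TreeLayers.ncard_sphere_eq_of_biregular` [Serre, *Trees* I.2.3, II.1.1]
for the parity type function) at `n = 2m + 1`, plus exponent bookkeeping.

Cell `hodgecm-mathlib`, crux H413 (`stmt-HodgeConjecture-24833`), route of record `HCCMUnconditional`; programme R90-TF
(brief `director/R90-BRIEF.v2.md` 1f40d54518340a35), section S6 (base `R90-C14`), seat R90-C14-p03 (g2); WAVE 6 sheet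
`R90/R90-C14-plan/g2/S6_wave6_targets.v1.R90-C14-plan-g2.lean` 82d8032ceb473274 (AUDIT BOX S6#W6 CLEAN ×4), target W6-b′
signature VERBATIM (ns without `.Wave6`).  Lane `--supports stmt-HodgeConjecture-24833 --as helper`; Mathlib + ★ Theorems only,
no definition, no kit, no posited object, no `sorry`.
HONEST LABEL: generic graph theory, count-neutral until the E1-c assembly consumes it; HC_CM is proved only modulo the 7 printed
citations (2 remaining named inputs: hLiu418 = stmt-HodgeConjecture-24832, h413 = stmt-HodgeConjecture-24833) until rung 0 closes.
-/

set_option autoImplicit false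
-- the mandated namespace repeats the single-problem summit's segment (`HodgeConjecture.HodgeConjecture`)
set_option linter.dupNamespace false

open SimpleGraph

namespace Summit.HodgeConjecture.HodgeConjecture.R90.S6

variable {V : Type*} (G : SimpleGraph V)

/-- **(W6-b′) odd spheres of a bi-regular tree**: in a locally finite tree in which every vertex at EVEN distance from `x₀`
has degree `a + 1` and every vertex at ODD distance has degree `b + 1`, the sphere of radius `2m + 1` about `x₀` has
`(a+1)·(ab)^m` vertices (special vertices at distance `2m+1`). [Serre, *Trees* II.1.1; Rogawski 1990 §4.9 counting road] -/
theorem ncard_sphere_odd_of_biregular_tree (hG : G.IsTree) [G.LocallyFinite] (x₀ : V) (a b : ℕ)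
    (hdeg : ∀ x : V, G.degree x = if Even (G.dist x₀ x) then a + 1 else b + 1) (m : ℕ) :
    {x : V | G.dist x₀ x = 2 * m + 1}.ncard = (a + 1) * (a * b) ^ m := by
  rw [ncard_sphere_eq_of_parity_biregular_tree G hG x₀ a b hdeg (2 * m + 1) (by omega)]
  have e1 : (2 * m + 1) / 2 = m := by omega
  have e2 : (2 * m + 1 - 1) / 2 = m := by omega
  rw [e1, e2, mul_pow]
  ring

end Summit.HodgeConjecture.HodgeConjecture.R90.S6
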